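import Summits.CriticalPhenomena.PercolationContinuityZ3.Theorems.PercNearOneGluingNoHeavyQuantFarSunGame
import Mathlib.Tactic.IntervalCases
import HarnessLib

/-!
# FAR beyond trees: REGION II CERTIFICATES — delay-2 budget games for the high-mass slabs, `K = 13`, cells [7/40, 9/40), [9/40, 1/4); `K = 13`, cells [1/4, 2/7)

builds on p205010 (kernel theorem, internal audit signed; external expert review pending)

Support file (`--supports stmt-CriticalPhenomena-4575`), seat `prim-cert-1` (gen 39); memo `prim-cert-1/FROM-prim-cert-1-g39-VERTEX-GAME.md` §0(iv)–(vi), §5.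
COMPUTATIONAL (`native_decide`).  A CELL is `K` together with an interval `[lo, hi)` for the least hair weight `η` below the box threshold `η₁(K)`;
on `R` such configurations have `Σh > S_min = 2 + 2F/hi` (Chernoff bound for `F`, iterated; the analytic side is a separate file).  The game alphabet is
`lo < g₁ < … < 1` (probabilities `k_i/q`), letter weights = the next letter in units `u` (so that every vertex word `w` of the cell box of a configuration `h`
has budget `Σ_k wt(w_k) ≥ Σh/u`), and the certificate covers all budgets `B_min ≤ B ≤ K·wt_max` with `B_min = ⌊S_min/u⌋ + 1`.  Consumed by
`HairyCycle.witGavg_ge_one_of_cellCert` (…GameAvg).  All instances were found exact-nonnegative beforehand (int128 engine, seat folder work/dpc/certplan.py).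
Elementary [this work]; no sorries; axioms standard + `Lean.ofReduceBool` (native_decide).
-/

namespace Summit.CriticalPhenomena.PercolationContinuityZ3.Theorems.HairyCycle

/-- Region II certificate `K = 13`, cell `η ∈ [7/40, 9/40)`: letters `['7/40', '1/2', '3/4', '1']` (over `q = 40`), weights `[2, 3, 4, 4]` (unit `1/4`),
caps `(8,2,3)`, `Lpay = 60`; budgets `44 … 52` (`S_min = 10.851`). [this work] -/
theorem cellCert_13_0 : (⟨8, 2, 3, 13, 40, 60, [(7, 2), (20, 3), (30, 4), (40, 4)]⟩ : GameSpec).gameCert 52 13 (List.range' 44 9) = true := by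
  native_decide

/-- Its specification is well formed. [this work] -/
theorem cellWF_13_0 : (⟨8, 2, 3, 13, 40, 60, [(7, 2), (20, 3), (30, 4), (40, 4)]⟩ : GameSpec).WF where
  q_pos := by decide
  k_le := by
    intro i hi
    have : i < 4 := hi
    interval_cases i <;> decide
  Kcred4 := by decide
  Lpay_pos := by decide
  dvdA := by
    intro d h1 h2
    change d + 4 ≤ 8 at h2
    have h3 : d ≤ 4 := by omega
    interval_cases d <;> decide
  dvdK := by decide

/-- Region II certificate `K = 13`, cell `η ∈ [9/40, 1/4)`: letters `['9/40', '1/2', '3/4', '1']` (over `q = 40`), weights `[2, 3, 4, 4]` (unit `1/4`),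
caps `(9,2,4)`, `Lpay = 60`; budgets `40 … 52` (`S_min = 9.929`). [this work] -/
theorem cellCert_13_1 : (⟨9, 2, 4, 13, 40, 60, [(9, 2), (20, 3), (30, 4), (40, 4)]⟩ : GameSpec).gameCert 52 13 (List.range' 40 13) = true := by
  native_decide

/-- Its specification is well formed. [this work] -/
theorem cellWF_13_1 : (⟨9, 2, 4, 13, 40, 60, [(9, 2), (20, 3), (30, 4), (40, 4)]⟩ : GameSpec).WF where
  q_pos := by decide
  k_le := by
    intro i hi
    have : i < 4 := hi
    interval_cases i <;> decide
  Kcred4 := by decide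
  Lpay_pos := by decide
  dvdA := by
    intro d h1 h2
    change d + 4 ≤ 9 at h2
    have h3 : d ≤ 5 := by omega
    interval_cases d <;> decide
  dvdK := by decide

/-- Region II certificate `K = 13`, cell `η ∈ [1/4, 2/7)`: letters `['1/4', '2/5', '3/5', '4/5', '1']` (over `q = 20`), weights `[2, 3, 4, 5, 5]` (unit `1/5`),
caps `(9,2,4)`, `Lpay = 60`; budgets `45 … 65` (`S_min = 8.855`). [this work] -/
theorem cellCert_13_2 : (⟨9, 2, 4, 13, 20, 60, [(5, 2), (8, 3), (12, 4), (16, 5), (20, 5)]⟩ : GameSpec).gameCert 65 13 (List.range' 45 21) = true := by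
  native_decide

/-- Its specification is well formed. [this work] -/
theorem cellWF_13_2 : (⟨9, 2, 4, 13, 20, 60, [(5, 2), (8, 3), (12, 4), (16, 5), (20, 5)]⟩ : GameSpec).WF where
  q_pos := by decide
  k_le := by
    intro i hi
    have : i < 5 := hi
    interval_cases i <;> decide
  Kcred4 := by decide
  Lpay_pos := by decide
  dvdA := by
    intro d h1 h2
    change d + 4 ≤ 9 at h2
    have h3 : d ≤ 5 := by omega
    interval_cases d <;> decide
  dvdK := by decide

end Summit.CriticalPhenomena.PercolationContinuityZ3.Theorems.HairyCycle
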